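import Mathlib
import Summits.KontsevichZagierPeriods.KontsevichZagierPeriods.Theorems.SoloInformedKummerBisection
import HarnessLib
import HarnessLib.Audit

/-!
# Kummer family II: bisection of the complementary quadrant arc, second kind (s39)

LEMMA XXVIII.2 (second kind) of the residency paper (§6quattuordecies); notation of part I
(`k'² = 1 − k²`, `f = ((1−t²)(1−k'²t²))^{-1/2}`, `s_k = 1/√(1+k)`, `τ = √(1−t²)/√(1−k'²t²)`),
`g = (1 − k'²t²)·f` the second-kind integrand.  In `P`:
  `2·⟦[(0,s_k), g]⟧ = ⟦[(0,1), g]⟧ + ⟦[pt, 1 − k]⟧`  (numerically `2E(φ_k,k') = E(k') + 1 − k`).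
Moves: the involution move of part I transports `[(s_k,1), g]` to `W = [(0,s_k), k²f/(1−k'²t²)]`;
rule (1b) splits `[(0,s_k), g] = W + [(0,s_k), h']` with the ALGEBRAIC primitive
`h = k'²·t·√(1−t²)/√(1−k'²t²)` (`h(0) = 0`, `h(s_k) = 1 − k`); ONE Newton–Leibniz move over the
point on the closed slab `[0,s_k]` gives `[[0,s_k], h'] ∼ [pt, 1−k]`.  With part I this is the
torsion input of COROLLARY XXVIII.1 at `n = k`.

References: A. M. Legendre, Traité des fonctions elliptiques I (1825), ch. VI; M. Abramowitz –
I. Stegun, Handbook (1964), 17.4.17–18, 17.7.14; D. F. Lawden, Elliptic Functions and Applications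
(1989), § 3.8; M. Kontsevich – D. Zagier, Periods (2001), § 1.2; this work.
-/

noncomputable section

open MeasureTheory Set Filter
open scoped Classical

open Literature.NumberTheory.Transcendental Literature.NumberTheory.Transcendental.KZ
open Literature.ModelTheory.ExponentialFields

namespace Summit.KontsevichZagierPeriods.KontsevichZagierPeriods.Theorems

/-! ### The closed slab `[0, s_k]` -/

/-- On the closed slab `0 ≤ t ≤ s_k` both radicands are positive. [folklore] -/
theorem soloInformed_bisection_closedSlab_pos {k t : ℝ} (hk : k ∈ Ioo (0:ℝ) 1)
    (ht : t ∈ Icc (0:ℝ) (√(1 + k))⁻¹) : 0 < 1 - t ^ 2 ∧ 0 < 1 - (1 - k ^ 2) * t ^ 2 := by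
  obtain ⟨hs0, hs1, hs2⟩ := soloInformed_bisectionPoint hk
  have h2 : t ^ 2 ≤ ((√(1 + k))⁻¹) ^ 2 := pow_le_pow_left₀ ht.1 ht.2 2
  have h3 : ((√(1 + k))⁻¹) ^ 2 < 1 := by rw [hs2]; exact inv_lt_one_of_one_lt₀ (by linarith [hk.1])
  have hk2 : 0 < k ^ 2 := pow_pos hk.1 2
  constructor <;> nlinarith [hk.2, sq_nonneg t]

/-- The closed slab `{x | 0 ≤ x₀ ≤ s_k}` is `ℚ`-semialgebraic and carries the `ℚ`-semialgebraic
functions `1 − x₀²`, `1 − k'²x₀²` (`k` algebraic). [BCR 1998, § 2.2] -/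
theorem soloInformed_bisection_closedSlab_sa {k : ℝ} (hk : k ∈ Ioo (0:ℝ) 1)
    (hka : IsAlgebraic ℚ k) :
    IsSemialgebraic ℚ {x : Fin 1 → ℝ | x 0 ∈ Icc (0:ℝ) (√(1 + k))⁻¹} ∧
    IsSemialgebraicFunOn ℚ {x : Fin 1 → ℝ | x 0 ∈ Icc (0:ℝ) (√(1 + k))⁻¹}
      (fun x : Fin 1 → ℝ => 1 - x 0 ^ 2) ∧
    IsSemialgebraicFunOn ℚ {x : Fin 1 → ℝ | x 0 ∈ Icc (0:ℝ) (√(1 + k))⁻¹}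
      (fun x : Fin 1 → ℝ => 1 - (1 - k ^ 2) * x 0 ^ 2) := by
  obtain ⟨hs0, hs1, hs2⟩ := soloInformed_bisectionPoint hk
  have hsa := soloInformed_bisectionPoint_isAlgebraic hk hka
  have hC : IsSemialgebraic ℚ {x : Fin 1 → ℝ | x 0 ∈ Icc (0:ℝ) (√(1 + k))⁻¹} := by
    have e : {x : Fin 1 → ℝ | x 0 ∈ Icc (0:ℝ) (√(1 + k))⁻¹} =
        {x : Fin 1 → ℝ | x 0 < 0}ᶜ ∩ {x : Fin 1 → ℝ | (√(1 + k))⁻¹ < x 0}ᶜ := by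
      ext x; simp only [mem_setOf_eq, mem_Icc, mem_inter_iff, mem_compl_iff, not_lt]
    rw [e]
    exact (isSemialgebraic_setOf_apply_lt_const isAlgebraic_zero 0).compl.inter
      (isSemialgebraic_setOf_const_lt_apply hsa 0).compl
  refine ⟨hC, ?_, ?_⟩
  · refine ((isSemialgebraicFunOn_const_of_isAlgebraic hC isAlgebraic_one).sub_holds
      (isSemialgebraicFunOn_aeval hC (MvPolynomial.X 0 ^ 2))).congr fun x _ => ?_
    simp only [Pi.sub_apply, map_pow, MvPolynomial.aeval_X]
  · refine ((isSemialgebraicFunOn_const_of_isAlgebraic hC isAlgebraic_one).sub_holds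
      ((isSemialgebraicFunOn_const_of_isAlgebraic hC (isAlgebraic_one.sub (hka.pow 2))).mul_holds
        (isSemialgebraicFunOn_aeval hC (MvPolynomial.X 0 ^ 2)))).congr fun x _ => ?_
    simp only [Pi.sub_apply, Pi.mul_apply, map_pow, MvPolynomial.aeval_X]

/-! ### The transported second-kind integrand and the algebraic primitive -/

/-- `g(τ(t))·|τ'(t)| = k²f(t)/(1−k'²t²)` on `(0,1)`. [this work] -/
theorem soloInformed_bisection_involution_integrandE {k t : ℝ} (hk : k ∈ Ioo (0:ℝ) 1)
    (ht : t ∈ Ioo (0:ℝ) 1) :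
    k ^ 2 / (1 - (1 - k ^ 2) * t ^ 2) * ((√(1 - t ^ 2))⁻¹ * (√(1 - (1 - k ^ 2) * t ^ 2))⁻¹) =
      (1 - (1 - k ^ 2) * (√(1 - t ^ 2) / √(1 - (1 - k ^ 2) * t ^ 2)) ^ 2) *
          ((√(1 - (√(1 - t ^ 2) / √(1 - (1 - k ^ 2) * t ^ 2)) ^ 2))⁻¹ *
            (√(1 - (1 - k ^ 2) * (√(1 - t ^ 2) / √(1 - (1 - k ^ 2) * t ^ 2)) ^ 2))⁻¹) *
        |-(k ^ 2 * t) * ((√(1 - t ^ 2))⁻¹ * (√(1 - (1 - k ^ 2) * t ^ 2))⁻¹) /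
          (1 - (1 - k ^ 2) * t ^ 2)| := by
  rw [mul_assoc, ← soloInformed_bisection_jacobian hk ht,
    (soloInformed_bisection_involution_sq ht).2]

/-- The algebraic primitive `h(t) = k'²·t·√(1−t²)/√(1−k'²t²)` has
`h'(t) = (1 − k'²t² − k²/(1−k'²t²))·f(t)` on `(0,1)`. [this work] -/
theorem soloInformed_bisection_primitive_hasDerivAt {k t : ℝ} (ht : t ∈ Ioo (0:ℝ) 1) :
    HasDerivAt (fun y : ℝ => (1 - k ^ 2) * (y * (√(1 - y ^ 2) * (√(1 - (1 - k ^ 2) * y ^ 2))⁻¹)))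
      ((1 - (1 - k ^ 2) * t ^ 2 - k ^ 2 / (1 - (1 - k ^ 2) * t ^ 2)) *
        ((√(1 - t ^ 2))⁻¹ * (√(1 - (1 - k ^ 2) * t ^ 2))⁻¹)) t := by
  have hu0 : 0 < 1 - t ^ 2 := by nlinarith [ht.1, ht.2]
  have hv0 : 0 < 1 - (1 - k ^ 2) * t ^ 2 := soloInformed_legendre_radicand_pos' ht (sq_nonneg k)
  have hU : √(1 - t ^ 2) ≠ 0 := (Real.sqrt_pos.2 hu0).ne'
  have hV : √(1 - (1 - k ^ 2) * t ^ 2) ≠ 0 := (Real.sqrt_pos.2 hv0).ne'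
  have hR : 1 - (1 - k ^ 2) * t ^ 2 ≠ 0 := hv0.ne'
  have hu : HasDerivAt (fun y : ℝ => √(1 - y ^ 2)) ((0 - 2 * t) / (2 * √(1 - t ^ 2))) t :=
    ((hasDerivAt_const t (1:ℝ)).sub (soloInformed_hasDerivAt_sq t)).sqrt hu0.ne'
  have hv : HasDerivAt (fun y : ℝ => 1 - (1 - k ^ 2) * y ^ 2) (0 - (1 - k ^ 2) * (2 * t)) t :=
    (hasDerivAt_const t (1:ℝ)).sub ((soloInformed_hasDerivAt_sq t).const_mul (1 - k ^ 2))
  have hvi : HasDerivAt (fun y : ℝ => (√(1 - (1 - k ^ 2) * y ^ 2))⁻¹)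
      ((1 - k ^ 2) * t / (1 - (1 - k ^ 2) * t ^ 2) * (√(1 - (1 - k ^ 2) * t ^ 2))⁻¹) t :=
    soloInformed_hasDerivAt_inv_sqrt hv hv0 _ (by field_simp; ring)
  refine (((hasDerivAt_id' t).mul (hu.mul hvi)).const_mul (1 - k ^ 2)).congr_deriv ?_
  simp only [Pi.mul_apply]
  have e1 : √(1 - t ^ 2) * (√(1 - (1 - k ^ 2) * t ^ 2))⁻¹ =
      √(1 - t ^ 2) ^ 2 * ((√(1 - t ^ 2))⁻¹ * (√(1 - (1 - k ^ 2) * t ^ 2))⁻¹) := by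
    field_simp
  have e2 : (0 - 2 * t) / (2 * √(1 - t ^ 2)) * (√(1 - (1 - k ^ 2) * t ^ 2))⁻¹ =
      -t * ((√(1 - t ^ 2))⁻¹ * (√(1 - (1 - k ^ 2) * t ^ 2))⁻¹) := by
    field_simp; ring
  have e3 : √(1 - t ^ 2) * ((1 - k ^ 2) * t / (1 - (1 - k ^ 2) * t ^ 2) *
      (√(1 - (1 - k ^ 2) * t ^ 2))⁻¹) = (1 - k ^ 2) * t / (1 - (1 - k ^ 2) * t ^ 2) *
        √(1 - t ^ 2) ^ 2 * ((√(1 - t ^ 2))⁻¹ * (√(1 - (1 - k ^ 2) * t ^ 2))⁻¹) := by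
    field_simp
  rw [e1, e2, e3, Real.sq_sqrt hu0.le]
  field_simp
  ring

/-- The value of the primitive at the bisection point: `h(s_k) = k'² s_k² = 1 − k`. [this work] -/
theorem soloInformed_bisection_primitive_at_s {k : ℝ} (hk : k ∈ Ioo (0:ℝ) 1) :
    (1 - k ^ 2) * ((√(1 + k))⁻¹ * (√(1 - ((√(1 + k))⁻¹) ^ 2) *
      (√(1 - (1 - k ^ 2) * ((√(1 + k))⁻¹) ^ 2))⁻¹)) = 1 - k := by
  obtain ⟨hs0, hs1, hs2⟩ := soloInformed_bisectionPoint hk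
  have h1k : (1:ℝ) + k ≠ 0 := by linarith [hk.1]
  have hq : (1 - k ^ 2) * (1 + k)⁻¹ = 1 - k := by field_simp; ring
  have hv0 : 0 < 1 - (1 - k ^ 2) * ((√(1 + k))⁻¹) ^ 2 := by rw [hs2, hq]; linarith [hk.1]
  have hid : 1 - ((√(1 + k))⁻¹) ^ 2 =
      ((√(1 + k))⁻¹) ^ 2 * (1 - (1 - k ^ 2) * ((√(1 + k))⁻¹) ^ 2) := by
    rw [hs2]; field_simp; ring
  rw [hid, Real.sqrt_mul (pow_nonneg hs0.le 2), Real.sqrt_sq hs0.le, mul_assoc,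
    mul_inv_cancel₀ (Real.sqrt_pos.2 hv0).ne', mul_one, ← pow_two, hs2, hq]

/-! ### The auxiliary representations `W = [(0,s_k), k²f/(1−k'²t²)]`, `D = [[0,s_k], h']` -/

/-- `W = [(0,s_k), k²f/(1−k'²t²)]` is an integral representation (dominated by `F̃_k`).
[this work] -/
theorem soloInformed_exists_kummerW_rep (k : ℝ) (hk : k ∈ Ioo (0:ℝ) 1) (hka : IsAlgebraic ℚ k) :
    ∃ W : IntegralRep 1, W.domain = {x | x 0 ∈ Ioo (0:ℝ) (√(1 + k))⁻¹} ∧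
      ∀ x, W.integrand x = k ^ 2 / (1 - (1 - k ^ 2) * x 0 ^ 2) *
        ((√(1 - x 0 ^ 2))⁻¹ * (√(1 - (1 - k ^ 2) * x 0 ^ 2))⁻¹) := by
  obtain ⟨hs0, hs1, hs2⟩ := soloInformed_bisectionPoint hk
  obtain ⟨F, hFd, hFi⟩ := soloInformed_exists_incompleteF_rep k hk hka
  have hFfun : F.integrand = fun x => (√(1 - x 0 ^ 2))⁻¹ * (√(1 - (1 - k ^ 2) * x 0 ^ 2))⁻¹ :=
    funext hFi
  have hLo : IsSemialgebraic ℚ {x : Fin 1 → ℝ | x 0 ∈ Ioo (0:ℝ) (√(1 + k))⁻¹} := by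
    rw [← hFd]; exact F.isSemialgebraic_domain
  have hf := F.isSemialgebraicFunOn_integrand
  have hfint := F.integrableOn
  rw [hFd, hFfun] at hf hfint
  have hrad : ∀ x ∈ {x : Fin 1 → ℝ | x 0 ∈ Ioo (0:ℝ) (√(1 + k))⁻¹},
      x 0 ∈ Ioo (0:ℝ) 1 ∧ 0 < 1 - (1 - k ^ 2) * x 0 ^ 2 := fun x hx => ⟨⟨hx.1, hx.2.trans hs1⟩,
    soloInformed_legendre_radicand_pos' ⟨hx.1, hx.2.trans hs1⟩ (sq_nonneg k)⟩
  have h2 : IsSemialgebraicFunOn ℚ {x : Fin 1 → ℝ | x 0 ∈ Ioo (0:ℝ) (√(1 + k))⁻¹}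
      (fun x : Fin 1 → ℝ => 1 - (1 - k ^ 2) * x 0 ^ 2) := by
    refine ((isSemialgebraicFunOn_const_of_isAlgebraic hLo isAlgebraic_one).sub_holds
      ((isSemialgebraicFunOn_const_of_isAlgebraic hLo (isAlgebraic_one.sub (hka.pow 2))).mul_holds
        (isSemialgebraicFunOn_aeval hLo (MvPolynomial.X 0 ^ 2)))).congr fun x _ => ?_
    simp only [Pi.sub_apply, Pi.mul_apply, map_pow, MvPolynomial.aeval_X]
  have hsa : IsSemialgebraicFunOn ℚ {x : Fin 1 → ℝ | x 0 ∈ Ioo (0:ℝ) (√(1 + k))⁻¹}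
      (fun x : Fin 1 → ℝ => k ^ 2 / (1 - (1 - k ^ 2) * x 0 ^ 2) *
        ((√(1 - x 0 ^ 2))⁻¹ * (√(1 - (1 - k ^ 2) * x 0 ^ 2))⁻¹)) :=
    (((isSemialgebraicFunOn_const_of_isAlgebraic hLo (hka.pow 2)).mul_holds
      (h2.inv fun x hx => (hrad x hx).2.ne')).mul_holds hf).congr
      fun x _ => by simp only [Pi.mul_apply, div_eq_mul_inv]
  have hmeas : MeasurableSet {x : Fin 1 → ℝ | x 0 ∈ Ioo (0:ℝ) (√(1 + k))⁻¹} :=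
    (measurable_pi_apply 0) measurableSet_Ioo
  refine ⟨⟨_, _, hLo, hsa, ?_⟩, rfl, fun _ => rfl⟩
  refine Integrable.mono' hfint
    (by fun_prop : Measurable fun x : Fin 1 → ℝ => k ^ 2 / (1 - (1 - k ^ 2) * x 0 ^ 2) *
      ((√(1 - x 0 ^ 2))⁻¹ * (√(1 - (1 - k ^ 2) * x 0 ^ 2))⁻¹)).aestronglyMeasurable
    ((ae_restrict_iff' hmeas).2 (ae_of_all _ fun x hx => ?_))
  obtain ⟨hx1, hv0⟩ := hrad x hx
  have hf0 : 0 ≤ (√(1 - x 0 ^ 2))⁻¹ * (√(1 - (1 - k ^ 2) * x 0 ^ 2))⁻¹ := by positivity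
  have hle : k ^ 2 / (1 - (1 - k ^ 2) * x 0 ^ 2) ≤ 1 := by
    rw [div_le_one hv0]
    nlinarith [mul_nonneg (sub_nonneg.2 (pow_le_one₀ hk.1.le hk.2.le : k ^ 2 ≤ 1))
      (sub_nonneg.2 (pow_le_one₀ hx1.1.le hx1.2.le : x 0 ^ 2 ≤ 1))]
  rw [Real.norm_eq_abs, abs_of_nonneg (mul_nonneg (div_nonneg (sq_nonneg k) hv0.le) hf0)]
  exact (mul_le_mul_of_nonneg_right hle hf0).trans_eq (one_mul _)

/-- `D = [[0,s_k], h']`, `h' = (1 − k'²t² − k²/(1−k'²t²))·f`, is an integral representation on the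
CLOSED slab (continuous integrand on a compact slab). [this work] -/
theorem soloInformed_exists_kummerD_rep (k : ℝ) (hk : k ∈ Ioo (0:ℝ) 1) (hka : IsAlgebraic ℚ k) :
    ∃ D : IntegralRep 1, D.domain = {x | x 0 ∈ Icc (0:ℝ) (√(1 + k))⁻¹} ∧
      ∀ x, D.integrand x = (1 - (1 - k ^ 2) * x 0 ^ 2 - k ^ 2 / (1 - (1 - k ^ 2) * x 0 ^ 2)) *
        ((√(1 - x 0 ^ 2))⁻¹ * (√(1 - (1 - k ^ 2) * x 0 ^ 2))⁻¹) := by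
  obtain ⟨hC, hp1, hp2⟩ := soloInformed_bisection_closedSlab_sa hk hka
  have hpos := fun x (hx : x ∈ {x : Fin 1 → ℝ | x 0 ∈ Icc (0:ℝ) (√(1 + k))⁻¹}) =>
    soloInformed_bisection_closedSlab_pos hk (t := x 0) hx
  have hsa : IsSemialgebraicFunOn ℚ {x : Fin 1 → ℝ | x 0 ∈ Icc (0:ℝ) (√(1 + k))⁻¹}
      (fun x : Fin 1 → ℝ => (1 - (1 - k ^ 2) * x 0 ^ 2 - k ^ 2 / (1 - (1 - k ^ 2) * x 0 ^ 2)) *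
        ((√(1 - x 0 ^ 2))⁻¹ * (√(1 - (1 - k ^ 2) * x 0 ^ 2))⁻¹)) :=
    ((hp2.sub_holds ((isSemialgebraicFunOn_const_of_isAlgebraic hC (hka.pow 2)).mul_holds
      (hp2.inv fun x hx => (hpos x hx).2.ne'))).mul_holds
      (((IsSemialgebraicFunOn.sqrt_holds hp1).inv fun x hx =>
        (Real.sqrt_pos.2 (hpos x hx).1).ne').mul_holds
        ((IsSemialgebraicFunOn.sqrt_holds hp2).inv fun x hx =>
          (Real.sqrt_pos.2 (hpos x hx).2).ne'))).congr
      fun x _ => by simp only [Pi.mul_apply, Pi.sub_apply, div_eq_mul_inv]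
  have hcont : ContinuousOn (fun t : ℝ => (1 - (1 - k ^ 2) * t ^ 2 -
      k ^ 2 / (1 - (1 - k ^ 2) * t ^ 2)) * ((√(1 - t ^ 2))⁻¹ * (√(1 - (1 - k ^ 2) * t ^ 2))⁻¹))
      (Icc 0 (√(1 + k))⁻¹) := by
    have hR : Continuous fun t : ℝ => 1 - (1 - k ^ 2) * t ^ 2 := by fun_prop
    have hU : Continuous fun t : ℝ => √(1 - t ^ 2) := by fun_prop
    refine (hR.continuousOn.sub (continuousOn_const.div hR.continuousOn fun t ht =>
      (soloInformed_bisection_closedSlab_pos hk ht).2.ne')).mul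
      ((hU.continuousOn.inv₀ fun t ht => (Real.sqrt_pos.2
        (soloInformed_bisection_closedSlab_pos hk ht).1).ne').mul
        (hR.sqrt.continuousOn.inv₀ fun t ht => (Real.sqrt_pos.2
          (soloInformed_bisection_closedSlab_pos hk ht).2).ne'))
  have hK : IsCompact (Set.pi univ fun _ : Fin 1 => Icc (0:ℝ) (√(1 + k))⁻¹) :=
    isCompact_univ_pi fun _ => isCompact_Icc
  refine ⟨⟨_, _, hC, hsa, ?_⟩, rfl, fun _ => rfl⟩
  refine ((hcont.comp (continuous_apply 0).continuousOn fun x hx => (mem_univ_pi.mp hx) 0)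
    |>.integrableOn_compact hK).mono_set fun x hx => ?_
  exact mem_univ_pi.mpr fun i => by rw [Subsingleton.elim i 0]; exact hx

/-! ### Newton–Leibniz over the point on a closed slab `[0, b]` with algebraic `b` -/

/-- **Newton–Leibniz on `[0, b]` over a point** (`b ≥ 0` algebraic): `r.domain = [0,b]`, `x ↦ φ(x₀)`
semialgebraic there, `φ` continuous on `[0,b]` with `φ' = r.integrand` on `(0,b)`; then
`[r] − [pt, φ(b) − φ(0)]` is ONE Newton–Leibniz move. [Kontsevich–Zagier 2001, § 1.2 rule (3)] -/
theorem soloInformed_of_sub_unitConstMul_mem_relations (r : IntegralRep 1) {b : ℝ}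
    (hb : IsAlgebraic ℚ b) (hb0 : 0 ≤ b) (hr : r.domain = {x | x 0 ∈ Icc (0:ℝ) b}) (φ : ℝ → ℝ)
    (hφ : IsSemialgebraicFunOn ℚ r.domain fun x => φ (x 0))
    (hφc : ContinuousOn φ (Icc 0 b))
    (hφd : ∀ t ∈ Ioo 0 b, HasDerivAt φ (r.integrand fun _ => t) t)
    {c : ℝ} (hc : IsAlgebraic ℚ c) (hcφ : c = φ b - φ 0) :
    of r - of (IntegralRep.unit.constMul c hc) ∈ relations := by
  have e : ∀ (x : Fin 0 → ℝ) (u : ℝ), (Fin.snoc x u : Fin 1 → ℝ) = fun _ => u := fun x u => by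
    funext i
    rw [Subsingleton.elim (α := Fin 1) i (Fin.last 0)]
    exact Fin.snoc_last (α := fun _ => ℝ) (x := u) (p := x)
  refine newtonLeibnizRel_subset_relations ⟨0, r, _, fun _ => (0:ℝ), fun _ => b,
    fun z => φ (z 0), hφ, ?_, ?_, fun _ _ => hb0, ?_, ?_, ?_, ?_, rfl⟩
  · exact isSemialgebraicFunOn_const_of_isAlgebraic isSemialgebraic_univ isAlgebraic_zero
  · exact isSemialgebraicFunOn_const_of_isAlgebraic isSemialgebraic_univ hb
  · rw [hr]
    ext z
    simp only [mem_setOf_eq, mem_Icc, IntegralRep.domain_constMul, IntegralRep.unit_domain,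
      mem_univ, true_and]
    rfl
  · intro x _
    simpa only [e] using hφc
  · intro x _ t ht
    simpa only [e] using hφd t ht
  · intro x _
    simp only [e, IntegralRep.integrand_constMul, IntegralRep.unit_integrand, mul_one]
    exact hcφ

/-! ### LEMMA XXVIII.2 (second kind): `2⟦Ẽ_k⟧ = ⟦E'⟧ + (1−k)·1` -/

/-- **LEMMA XXVIII.2 (second kind) — bisection of the complementary quadrant arc in `P`.**
For real algebraic `0 < k < 1`, any representations `E' = [(0,1), g]` of `E(k')` and
`E = [(0,s_k), g]` of `E(φ_k,k')` (`g = (1−k'²t²)·((1−t²)(1−k'²t²))^{-1/2}`, `s_k = 1/√(1+k)`)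
satisfy `2·⟦E⟧ = ⟦E'⟧ + ⟦[pt, 1−k]⟧`: the involution move of part I, ONE rule-(1b) split
against the algebraic primitive `h = k'² t √(1−t²)/√(1−k'²t²)`, and ONE Newton–Leibniz move over
the point (`h(s_k) − h(0) = 1 − k`). [this work] -/
theorem soloInformed_kummer_bisection_E (k : ℝ) (hk : k ∈ Ioo (0:ℝ) 1) (hka : IsAlgebraic ℚ k)
    (E' E : IntegralRep 1) (hE'd : E'.domain = {x | x 0 ∈ Ioo (0:ℝ) 1})
    (hE'i : EqOn E'.integrand (fun x => (1 - (1 - k ^ 2) * x 0 ^ 2) *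
      ((√(1 - x 0 ^ 2))⁻¹ * (√(1 - (1 - k ^ 2) * x 0 ^ 2))⁻¹)) E'.domain)
    (hEd : E.domain = {x | x 0 ∈ Ioo (0:ℝ) (√(1 + k))⁻¹})
    (hEi : EqOn E.integrand (fun x => (1 - (1 - k ^ 2) * x 0 ^ 2) *
      ((√(1 - x 0 ^ 2))⁻¹ * (√(1 - (1 - k ^ 2) * x 0 ^ 2))⁻¹)) E.domain)
    (h1k : IsAlgebraic ℚ (1 - k)) :
    2 * toFormalPeriod (of E) =
      toFormalPeriod (of E') + toFormalPeriod (of (IntegralRep.unit.constMul (1 - k) h1k)) := by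
  obtain ⟨hs0, hs1, hs2⟩ := soloInformed_bisectionPoint hk
  have hsa := soloInformed_bisectionPoint_isAlgebraic hk hka
  have hLo : IsSemialgebraic ℚ {x : Fin 1 → ℝ | x 0 ∈ Ioo (0:ℝ) (√(1 + k))⁻¹} :=
    (isSemialgebraic_setOf_const_lt_apply isAlgebraic_zero 0).inter
      (isSemialgebraic_setOf_apply_lt_const hsa 0)
  have hHi : IsSemialgebraic ℚ {x : Fin 1 → ℝ | x 0 ∈ Ioo (√(1 + k))⁻¹ 1} :=
    (isSemialgebraic_setOf_const_lt_apply hsa 0).inter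
      (isSemialgebraic_setOf_apply_lt_const isAlgebraic_one 0)
  have hlo : {x : Fin 1 → ℝ | x 0 ∈ Ioo (0:ℝ) (√(1 + k))⁻¹} ⊆ E'.domain := fun x hx => by
    rw [hE'd]; exact ⟨hx.1, hx.2.trans hs1⟩
  have hup : {x : Fin 1 → ℝ | x 0 ∈ Ioo (√(1 + k))⁻¹ 1} ⊆ E'.domain := fun x hx => by
    rw [hE'd]; exact ⟨hs0.trans hx.1, hx.2⟩
  have hE : {x : Fin 1 → ℝ | x 0 ∈ Ioo (0:ℝ) (√(1 + k))⁻¹} ∪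
      {x : Fin 1 → ℝ | x 0 ∈ Ioo (√(1 + k))⁻¹ 1} ⊆ E'.domain := union_subset hlo hup
  have hvol : volume (E'.domain \ ({x : Fin 1 → ℝ | x 0 ∈ Ioo (0:ℝ) (√(1 + k))⁻¹} ∪
      {x : Fin 1 → ℝ | x 0 ∈ Ioo (√(1 + k))⁻¹ 1})) = 0 := by
    refine measure_mono_null (fun x hx => ?_)
      (BallPeeling.volume_setOf_apply_eq_const 1 0 (√(1 + k))⁻¹)
    rw [hE'd] at hx
    simp only [Set.mem_sdiff, mem_setOf_eq, mem_union, mem_Ioo, not_or, not_and, not_lt] at hx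
    obtain ⟨⟨h0, h1⟩, hlo', hup'⟩ := hx
    exact le_antisymm (not_lt.1 fun h => absurd (hup' h) (not_le.2 h1)) (hlo' h0)
  have h1 := IntegralRep.of_sub_of_restrict_mem_relations E' (hLo.union hHi) hE hvol
  have h2 : of (E'.restrict _ (hLo.union hHi) hE) - of (E'.restrict _ hLo hlo) -
      of (E'.restrict _ hHi hup) ∈ relations := by
    refine domainAddRel_subset_relations ⟨1, E'.restrict _ (hLo.union hHi) hE,
      E'.restrict _ hLo hlo, E'.restrict _ hHi hup, rfl, ?_, fun _ _ => rfl, fun _ _ => rfl, rfl⟩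
    rw [IntegralRep.domain_restrict, IntegralRep.domain_restrict]
    have : {x : Fin 1 → ℝ | x 0 ∈ Ioo (0:ℝ) (√(1 + k))⁻¹} ∩
        {x : Fin 1 → ℝ | x 0 ∈ Ioo (√(1 + k))⁻¹ 1} = ∅ := by
      ext x
      simp only [mem_inter_iff, mem_setOf_eq, mem_Ioo, mem_empty_iff_false, iff_false, not_and]
      exact fun h h' _ => by linarith [h.2, h']
    rw [this, measure_empty]
  -- (iii) the involution move transports the upper slab to `W`
  obtain ⟨W, hWd, hWi⟩ := soloInformed_exists_kummerW_rep k hk hka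
  have h3 : of W - of (E'.restrict _ hHi hup) ∈ relations := by
    refine changeOfVariablesRel_subset_relations (soloInformed_lift_mem_changeOfVariablesRel W _
      (g := fun t : ℝ => √(1 - t ^ 2) / √(1 - (1 - k ^ 2) * t ^ 2))
      (g' := fun t : ℝ => -(k ^ 2 * t) * ((√(1 - t ^ 2))⁻¹ * (√(1 - (1 - k ^ 2) * t ^ 2))⁻¹) /
        (1 - (1 - k ^ 2) * t ^ 2))
      (S := Ioo (0:ℝ) (√(1 + k))⁻¹) (T := Ioo (√(1 + k))⁻¹ 1) hWd
      (IntegralRep.domain_restrict _ _ _ _) ?_ (fun t ht => ?_) ?_ ?_ fun x hx => ?_)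
    · rw [hWd]
      exact soloInformed_bisection_involution_sa hk hka
    · exact soloInformed_bisection_involution_hasDerivAt ⟨ht.1, ht.2.trans hs1⟩
    · exact (soloInformed_bisection_involution_injOn hk).mono (Ioo_subset_Ioo_right hs1.le)
    · exact soloInformed_bisection_involution_image hk
    · have hxS : x 0 ∈ Ioo (0:ℝ) (√(1 + k))⁻¹ := by rw [hWd] at hx; exact hx
      have hmem : soloInformedLift (fun t : ℝ => √(1 - t ^ 2) / √(1 - (1 - k ^ 2) * t ^ 2)) x ∈
          (E'.restrict _ hHi hup).domain := soloInformed_bisection_involution_mem hk hxS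
      rw [hWi, IntegralRep.integrand_restrict, hE'i (hup hmem)]
      simp only [soloInformedLift]
      exact soloInformed_bisection_involution_integrandE hk ⟨hxS.1, hxS.2.trans hs1⟩
  -- (iv) `E` is the lower slab of `E'`
  have h4 : of E - of (E'.restrict _ hLo hlo) ∈ relations :=
    KZ.of_sub_of_mem_relations_of_eqOn (by rw [IntegralRep.domain_restrict, hEd]) fun x hx =>
      (hEi hx).trans (hE'i (hlo (by rw [hEd] at hx; exact hx))).symm
  -- (v) rule (1b) on the lower slab: `E'| = W + D|`
  obtain ⟨D, hDd, hDi⟩ := soloInformed_exists_kummerD_rep k hk hka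
  have hloD : {x : Fin 1 → ℝ | x 0 ∈ Ioo (0:ℝ) (√(1 + k))⁻¹} ⊆ D.domain := fun x hx => by
    rw [hDd]; exact ⟨le_of_lt hx.1, le_of_lt hx.2⟩
  have h5 : of (E'.restrict _ hLo hlo) - of W - of (D.restrict _ hLo hloD) ∈ relations := by
    refine integrandAddRel_subset_relations ⟨1, E'.restrict _ hLo hlo, W, D.restrict _ hLo hloD,
      by rw [hWd, IntegralRep.domain_restrict],
      by rw [IntegralRep.domain_restrict, IntegralRep.domain_restrict], fun x hx => ?_, rfl⟩
    have hxS : x 0 ∈ Ioo (0:ℝ) (√(1 + k))⁻¹ := hx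
    have hR : 1 - (1 - k ^ 2) * x 0 ^ 2 ≠ 0 :=
      (soloInformed_legendre_radicand_pos' ⟨hxS.1, hxS.2.trans hs1⟩ (sq_nonneg k)).ne'
    simp only [Pi.add_apply, IntegralRep.integrand_restrict, hWi, hDi, hE'i (hlo hx)]
    ring
  -- (vi) the null boundary `{0, s_k}` of `D`; (vii) Newton–Leibniz over the point
  have hvolD : volume (D.domain \ {x : Fin 1 → ℝ | x 0 ∈ Ioo (0:ℝ) (√(1 + k))⁻¹}) = 0 := by
    refine measure_mono_null (fun x hx => ?_) (measure_union_null
      (BallPeeling.volume_setOf_apply_eq_const 1 0 0)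
      (BallPeeling.volume_setOf_apply_eq_const 1 0 (√(1 + k))⁻¹))
    rw [hDd] at hx
    have h01 : x 0 ∈ Icc (0:ℝ) (√(1 + k))⁻¹ := hx.1
    by_contra hc
    simp only [mem_union, mem_setOf_eq, not_or] at hc
    exact hx.2 ⟨lt_of_le_of_ne h01.1 (Ne.symm hc.1), lt_of_le_of_ne h01.2 hc.2⟩
  have h6 := IntegralRep.of_sub_of_restrict_mem_relations D hLo hloD hvolD
  obtain ⟨hC, hp1, hp2⟩ := soloInformed_bisection_closedSlab_sa hk hka
  have h7 : of D - of (IntegralRep.unit.constMul (1 - k) h1k) ∈ relations := by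
    refine soloInformed_of_sub_unitConstMul_mem_relations D hsa hs0.le hDd
      (fun y => (1 - k ^ 2) * (y * (√(1 - y ^ 2) * (√(1 - (1 - k ^ 2) * y ^ 2))⁻¹))) ?_ ?_
      (fun t ht => ?_) h1k ?_
    · rw [hDd]
      refine ((isSemialgebraicFunOn_const_of_isAlgebraic hC
        (isAlgebraic_one.sub (hka.pow 2))).mul_holds ((isSemialgebraicFunOn_aeval hC
          (MvPolynomial.X 0)).mul_holds
          ((IsSemialgebraicFunOn.sqrt_holds hp1).mul_holds
            ((IsSemialgebraicFunOn.sqrt_holds hp2).inv fun x hx => (Real.sqrt_pos.2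
              (soloInformed_bisection_closedSlab_pos hk (t := x 0) hx).2).ne')))).congr
        fun x _ => ?_
      simp only [Pi.mul_apply, MvPolynomial.aeval_X]
    · have hR : Continuous fun t : ℝ => 1 - (1 - k ^ 2) * t ^ 2 := by fun_prop
      exact continuousOn_const.mul (continuousOn_id.mul
        ((by fun_prop : Continuous fun t : ℝ => √(1 - t ^ 2)).continuousOn.mul
          (hR.sqrt.continuousOn.inv₀ fun t ht => (Real.sqrt_pos.2
            (soloInformed_bisection_closedSlab_pos hk ht).2).ne')))
    · rw [hDi]
      exact soloInformed_bisection_primitive_hasDerivAt ⟨ht.1, ht.2.trans hs1⟩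
    · rw [soloInformed_bisection_primitive_at_s hk]
      simp
  have h : of E' + of (IntegralRep.unit.constMul (1 - k) h1k) - (of E + of E) ∈ relations := by
    have := relations.sub_mem (relations.add_mem (relations.sub_mem (relations.sub_mem
      (relations.sub_mem (relations.add_mem h1 h2) h3) (relations.add_mem h4 h4)) h5) h6) h7
    convert this using 1
    abel
  rw [two_mul, ← map_add, ← toFormalPeriod_eq_iff.mpr h, map_add]

/-- **LEMMA XXVIII.2 (second kind), numerically: `2E(φ_k, k') = E(k') + (1 − k)`.** [this work] -/
theorem soloInformed_kummer_bisection_E_value (k : ℝ) (hk : k ∈ Ioo (0:ℝ) 1)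
    (hka : IsAlgebraic ℚ k) (E' E : IntegralRep 1) (hE'd : E'.domain = {x | x 0 ∈ Ioo (0:ℝ) 1})
    (hE'i : EqOn E'.integrand (fun x => (1 - (1 - k ^ 2) * x 0 ^ 2) *
      ((√(1 - x 0 ^ 2))⁻¹ * (√(1 - (1 - k ^ 2) * x 0 ^ 2))⁻¹)) E'.domain)
    (hEd : E.domain = {x | x 0 ∈ Ioo (0:ℝ) (√(1 + k))⁻¹})
    (hEi : EqOn E.integrand (fun x => (1 - (1 - k ^ 2) * x 0 ^ 2) *
      ((√(1 - x 0 ^ 2))⁻¹ * (√(1 - (1 - k ^ 2) * x 0 ^ 2))⁻¹)) E.domain) :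
    2 * E.value = E'.value + (1 - k) := by
  have h1k : IsAlgebraic ℚ (1 - k) := isAlgebraic_one.sub hka
  have h := congr_arg evalP (soloInformed_kummer_bisection_E k hk hka E' E hE'd hE'i hEd hEi h1k)
  rw [map_mul, map_add, evalP_toFormalPeriod_of, evalP_toFormalPeriod_of, evalP_toFormalPeriod_of,
    IntegralRep.value_constMul, IntegralRep.value_unit, mul_one, map_ofNat] at h
  exact h

end Summit.KontsevichZagierPeriods.KontsevichZagierPeriods.Theorems

end
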